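import Summits.QuantumAdvantage.QuantumAdvantage.Theorems.CubicForrelationNearExactIsExactTwelveLevelFiveAlphaH3

/-!
# Crux `CubicForrelation.NearExactIsExact` (stmt-QuantumAdvantage-14043) — n = 12, open window, a LEVEL-5 side in CASE α: the sign bit `hb` is a
  RELATIVE CUBIC on the odd hyperplane (even parametrised 4-flat sections)

Certificate seat `b2b-cforr-cert` (gen 29).  HONEST FRAMING: kernel-checked finite-slice lemmas (standard axioms) about cubic Boolean pairs on 12
bits; second brick of PLAN-N12-WINDOW-ALPHA.md §A for case α (`A₂ = {4 ∤ e₅} ∩ P^c = c ⊕ V₁` an 8-flat, `tza_A2_flat`).  NO value of `θ₁₂`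
claimed; NOT summit progress.

* `tzw_alpha_H4par`: parity transfer for 4-flats: `#{ε ∈ 𝔽₂⁴ : hb(x ⊕ ε·a)} + #{ε : 4 ∤ e₅((x ⊕ ε·a) ⊕ t)}` is even (`x ∈ P`, `aᵢ ∈ V`,
  `t ∉ V`; from `8 ∣ Σ_{5-flat} e₅`, `l5c_flat5`, read mod 4).
* `tzw_A2_section4_even`: every parametrised 4-flat of the off-`P` coset meets the 8-flat `A₂` in an EVEN number of parameters (two of the
  16 parameters differ by an element of the period group `V₁` — pigeonhole over the 8 cosets of `V₁` in `V` — and translating by it is a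
  fixed-point-free involution of the section).
Together (successor): `hb` has even parametrised 4-flat sections on `P` (relative degree `≤ 3`; in the generic/rigid cases it was `≤ 2`).

References: J. Ax (1964) / R. J. McEliece (1972); MacWilliams–Sloane (1977) Ch. 13 §3.  Axioms: the standard three.
-/

set_option linter.dupNamespace false -- D-0017: single-problem summit ⇒ `QuantumAdvantage.QuantumAdvantage` by design

noncomputable section

namespace Summit.QuantumAdvantage.QuantumAdvantage.Theorems.CubicForrelation.NearExactIsExact

open Finset
open Literature.Computability.QuantumComplexity
open Literature.Computability.QuantumComplexity.BuzetChailloux (bxor zeroVec bxor_bxor_cancel_left bxor_zeroVec zeroVec_bxor bxor_comm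
  bxor_self)
open Literature.Computability.QuantumComplexity.DerivativeWalsh (W)

/-- **Parity transfer for 4-flats in case α.**  `x ∈ P`, `a₀,…,a₃ ∈ V`, `t ∉ V`: `#{ε : hb(x ⊕ ε·a) = 1} + #{ε : 4 ∤ e₅((x ⊕ ε·a) ⊕ t)}` is even.
[`8 ∣ Σ` over the 5-flat `x ⊕ ⟨t, a⟩` (`l5c_flat5`) read mod 4; `e₅ ≡ 1 − 2hb (mod 4)` on `P`, `e₅ ≡ 2·[4 ∤ e₅] (mod 4)` off `P`.] [this work] -/
theorem tzw_alpha_H4par (f g : (Fin (6 + 6) → Bool) → Bool) (hf : IsDegLeFun 3 f) (hg : IsDegLeFun 3 g)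
    (u' : (Fin (6 + 6) → Bool) → ℤ) (hu' : ∀ x, W (fun y => signOf (g y)) x = (2 : ℝ) ^ 5 * (u' x : ℝ))
    (V : Finset (Fin (6 + 6) → Bool)) (x₀ : Fin (6 + 6) → Bool) (h0 : zeroVec ∈ V) (hadd : ∀ a ∈ V, ∀ b ∈ V, bxor a b ∈ V)
    (hP : (univ.filter fun x : Fin (6 + 6) → Bool => Odd (u' x)) = V.image (bxor x₀))
    (hb : (Fin (6 + 6) → Bool) → Bool) (hhb : ∀ z, hb z = decide ((u' z - 2 * sZ (f z)) % 4 = 3))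
    {x a₀ a₁ a₂ a₃ t : Fin (6 + 6) → Bool} (hx : Odd (u' x)) (ha₀ : a₀ ∈ V) (ha₁ : a₁ ∈ V) (ha₂ : a₂ ∈ V) (ha₃ : a₃ ∈ V) (ht : t ∉ V) :
    Even (#(univ.filter fun ε : Fin 4 → Bool => hb (fun j => x j ^^ decide (Odd #(univ.filter fun i => ε i && (![a₀, a₁, a₂, a₃] : Fin 4 → Fin (6 + 6) → Bool) i j))) = true) +
      #(univ.filter fun ε : Fin 4 → Bool => ¬ (4 : ℤ) ∣ u' (bxor (fun j => x j ^^ decide (Odd #(univ.filter fun i => ε i && (![a₀, a₁, a₂, a₃] : Fin 4 → Fin (6 + 6) → Bool) i j))) t) - 2 * sZ (f (bxor (fun j => x j ^^ decide (Odd #(univ.filter fun i => ε i && (![a₀, a₁, a₂, a₃] : Fin 4 → Fin (6 + 6) → Bool) i j))) t)))) := by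
  classical
  set P := univ.filter (fun x : Fin (6 + 6) → Bool => Odd (u' x)) with hPdef
  set e : (Fin (6 + 6) → Bool) → ℤ := fun x => u' x - 2 * sZ (f x) with hedef
  have hxP : x ∈ P := mem_filter.2 ⟨mem_univ _, hx⟩
  have hPV : ∀ x, x ∈ P → ∀ a ∈ V, bxor x a ∈ P := fun x hx a ha => fl1_coset_vadd hadd hP hx ha
  have h8 := l5c_flat5 f g hf hg u' hu' x ![t, a₀, a₁, a₂, a₃]
  have e5 : (![t, a₀, a₁, a₂, a₃] : Fin 5 → Fin (6 + 6) → Bool) = Matrix.vecCons t ![a₀, a₁, a₂, a₃] := rfl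
  change (8 : ℤ) ∣ ∑ ε : Fin 5 → Bool, e (fun j => x j ^^ decide (Odd #(univ.filter fun i =>
        ε i && (![t, a₀, a₁, a₂, a₃] : Fin 5 → Fin (6 + 6) → Bool) i j))) at h8
  rw [e5, fr_sum_peel e x t ![a₀, a₁, a₂, a₃]] at h8
  have h4 := dvd_trans (show (4 : ℤ) ∣ 8 by norm_num) h8
  have ha : ∀ i, (![a₀, a₁, a₂, a₃] : Fin 4 → Fin (6 + 6) → Bool) i ∈ V := by intro i; fin_cases i <;> assumption
  have hin : ∀ ε : Fin 4 → Bool, (fun j => x j ^^ decide (Odd #(univ.filter fun i => ε i && (![a₀, a₁, a₂, a₃] : Fin 4 → Fin (6 + 6) → Bool) i j))) ∈ P := fun ε => fr_mem_flatPt4 V h0 (· ∈ P) hPV hxP _ ha ε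
  have hout : ∀ ε : Fin 4 → Bool, bxor (fun j => x j ^^ decide (Odd #(univ.filter fun i => ε i && (![a₀, a₁, a₂, a₃] : Fin 4 → Fin (6 + 6) → Bool) i j))) t ∉ P := fun ε => fl1_coset_out h0 hadd hP (hin ε) ht
  have hk : ∀ ε : Fin 4 → Bool, ∃ k : ℤ, e (fun j => x j ^^ decide (Odd #(univ.filter fun i => ε i && (![a₀, a₁, a₂, a₃] : Fin 4 → Fin (6 + 6) → Bool) i j))) = 1 - 2 * (if hb (fun j => x j ^^ decide (Odd #(univ.filter fun i => ε i && (![a₀, a₁, a₂, a₃] : Fin 4 → Fin (6 + 6) → Bool) i j))) = true then (1 : ℤ) else 0) + 4 * k := by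
    intro ε
    have hodd : Odd (u' (fun j => x j ^^ decide (Odd #(univ.filter fun i => ε i && (![a₀, a₁, a₂, a₃] : Fin 4 → Fin (6 + 6) → Bool) i j)))) := (mem_filter.1 (hin ε)).2
    obtain ⟨k, hk⟩ := tzl5_mod4 f u' hodd
    refine ⟨k, ?_⟩
    rw [hhb]
    have hs : sZ (decide ((u' (fun j => x j ^^ decide (Odd #(univ.filter fun i => ε i && (![a₀, a₁, a₂, a₃] : Fin 4 → Fin (6 + 6) → Bool) i j))) - 2 * sZ (f (fun j => x j ^^ decide (Odd #(univ.filter fun i => ε i && (![a₀, a₁, a₂, a₃] : Fin 4 → Fin (6 + 6) → Bool) i j))))) % 4 = 3)) =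
        1 - 2 * (if decide ((u' (fun j => x j ^^ decide (Odd #(univ.filter fun i => ε i && (![a₀, a₁, a₂, a₃] : Fin 4 → Fin (6 + 6) → Bool) i j))) - 2 * sZ (f (fun j => x j ^^ decide (Odd #(univ.filter fun i => ε i && (![a₀, a₁, a₂, a₃] : Fin 4 → Fin (6 + 6) → Bool) i j))))) % 4 = 3) = true then (1 : ℤ) else 0) := by
      cases decide ((u' (fun j => x j ^^ decide (Odd #(univ.filter fun i => ε i && (![a₀, a₁, a₂, a₃] : Fin 4 → Fin (6 + 6) → Bool) i j))) - 2 * sZ (f (fun j => x j ^^ decide (Odd #(univ.filter fun i => ε i && (![a₀, a₁, a₂, a₃] : Fin 4 → Fin (6 + 6) → Bool) i j))))) % 4 = 3) <;> simp [sZ]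
    simp only [e]
    linarith
  choose k hk using hk
  have hm : ∀ ε : Fin 4 → Bool, ∃ m : ℤ, e (bxor (fun j => x j ^^ decide (Odd #(univ.filter fun i => ε i && (![a₀, a₁, a₂, a₃] : Fin 4 → Fin (6 + 6) → Bool) i j))) t) = 2 * m := by
    intro ε
    have hne : ¬ Odd (u' (bxor (fun j => x j ^^ decide (Odd #(univ.filter fun i => ε i && (![a₀, a₁, a₂, a₃] : Fin 4 → Fin (6 + 6) → Bool) i j))) t)) := fun h => hout ε (mem_filter.2 ⟨mem_univ _, h⟩)
    obtain ⟨m, hm⟩ := Int.not_odd_iff_even.1 hne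
    exact ⟨m - sZ (f (bxor (fun j => x j ^^ decide (Odd #(univ.filter fun i => ε i && (![a₀, a₁, a₂, a₃] : Fin 4 → Fin (6 + 6) → Bool) i j))) t)), by simp only [e]; rw [hm]; ring⟩
  choose m hm using hm
  have hm4 : ∀ ε : Fin 4 → Bool, (¬ (4 : ℤ) ∣ e (bxor (fun j => x j ^^ decide (Odd #(univ.filter fun i => ε i && (![a₀, a₁, a₂, a₃] : Fin 4 → Fin (6 + 6) → Bool) i j))) t)) ↔ Odd (m ε) := by
    intro ε
    rw [hm ε, Int.odd_iff]
    constructor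
    · intro h; by_contra hne; exact h ⟨m ε / 2, by omega⟩
    · rintro h ⟨j, hj⟩; omega
  rw [sum_congr rfl (fun ε _ => hk ε), sum_congr rfl (fun ε _ => hm ε)] at h4
  rw [sum_add_distrib, sum_sub_distrib, sum_const, card_univ, ← mul_sum, ← mul_sum, ← mul_sum] at h4
  simp only [Fintype.card_fun, Fintype.card_bool, Fintype.card_fin] at h4
  rw [sum_boole] at h4
  have hfilt : (univ.filter fun ε : Fin 4 → Bool => ¬ (4 : ℤ) ∣ u' (bxor (fun j => x j ^^ decide (Odd #(univ.filter fun i => ε i && (![a₀, a₁, a₂, a₃] : Fin 4 → Fin (6 + 6) → Bool) i j))) t) - 2 * sZ (f (bxor (fun j => x j ^^ decide (Odd #(univ.filter fun i => ε i && (![a₀, a₁, a₂, a₃] : Fin 4 → Fin (6 + 6) → Bool) i j))) t))) =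
      univ.filter fun ε : Fin 4 → Bool => Odd (m ε) := filter_congr fun ε _ => hm4 ε
  rw [hfilt]
  have hM : Even (∑ ε : Fin 4 → Bool, m ε) ↔ Even #(univ.filter fun ε : Fin 4 → Bool => Odd (m ε)) := tw_even_sum_iff univ m
  set N := #(univ.filter fun ε : Fin 4 → Bool => hb (fun j => x j ^^ decide (Odd #(univ.filter fun i => ε i && (![a₀, a₁, a₂, a₃] : Fin 4 → Fin (6 + 6) → Bool) i j))) = true) with hN
  set N' := #(univ.filter fun ε : Fin 4 → Bool => Odd (m ε)) with hN'
  obtain ⟨q, hq⟩ := h4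
  simp only [nsmul_eq_mul] at hq
  norm_num at hq
  rw [Nat.even_iff, Int.even_iff] at hM
  rw [Nat.even_add, Nat.even_iff, Nat.even_iff]
  constructor
  · intro h; omega
  · intro h; omega

/-- **Every parametrised 4-flat of the off-`P` coset meets the 8-flat `A₂` evenly.**  `V ∋ 0` xor-closed with `#V = 2048`, `V₁ ⊆ V`
xor-closed with `#V₁ = 256`, `A = c' ⊕ V₁`; then for every `z ∈ c' ⊕ V` and `a : Fin 4 → V` the number of `ε ∈ 𝔽₂⁴` with
`z ⊕ ε·a ∈ A` is even.  [Two of the `16 > 8 = [V : V₁]` parameters have `ε·a` in the same `V₁`-coset; their difference `κ ≠ 0` has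
`κ·a ∈ V₁`, and `ε ↦ ε ⊕ κ` is a fixed-point-free involution of the section.] [folklore] -/
theorem tzw_A2_section4_even (V : Finset (Fin (6 + 6) → Bool)) (h0 : zeroVec ∈ V) (hadd : ∀ a ∈ V, ∀ b ∈ V, bxor a b ∈ V)
    (hcardV : #V = 2048) (V₁ : Finset (Fin (6 + 6) → Bool)) (hsub : V₁ ⊆ V)
    (h1add : ∀ a ∈ V₁, ∀ b ∈ V₁, bxor a b ∈ V₁) (h1card : #V₁ = 256)
    (c' : Fin (6 + 6) → Bool) (z : Fin (6 + 6) → Bool) (hz : z ∈ V.image (bxor c'))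
    (a : Fin 4 → Fin (6 + 6) → Bool) (ha : ∀ i, a i ∈ V) :
    Even #(univ.filter fun ε : Fin 4 → Bool => (fun j => z j ^^ decide (Odd #(univ.filter fun i => ε i && a i j))) ∈ V₁.image (bxor c')) := by
  classical
  set φ : (Fin 4 → Bool) → (Fin (6 + 6) → Bool) := fun ε => fun j => zeroVec j ^^ decide (Odd #(univ.filter fun i => ε i && a i j)) with hφ
  have hφadd : ∀ ε ε', φ (bxor ε ε') = bxor (φ ε) (φ ε') := fun ε ε' => ffr_flatPt_add a ε ε'
  have hφV : ∀ ε, φ ε ∈ V := fun ε => ws_flatPt_mem V h0 (· ∈ V) (fun w hw b hb' => hadd w hw b hb') 4 zeroVec h0 a ha ε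
  have hpt : ∀ ε, (fun j => z j ^^ decide (Odd #(univ.filter fun i => ε i && a i j))) = bxor z (φ ε) := fun ε => ws_flatPt_eq_bxor z a ε
  obtain ⟨w₀, hw₀, hzw⟩ := mem_image.1 hz
  -- membership of the flat point `ε` in `A` ⟺ `w₀ ⊕ φ ε ∈ V₁`
  have hmem : ∀ ε, (bxor z (φ ε) ∈ V₁.image (bxor c')) ↔ bxor w₀ (φ ε) ∈ V₁ := by
    intro ε
    rw [← hzw, iw_bxor_assoc]
    constructor
    · intro h
      obtain ⟨v, hv, hv'⟩ := mem_image.1 h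
      have := iw_bxor_injective c' hv'
      rw [← this]; exact hv
    · intro h; exact mem_image.2 ⟨_, h, rfl⟩
  -- pigeonhole: a non-zero parameter `κ` with `φ κ ∈ V₁`
  have hpig : ∃ κ : Fin 4 → Bool, κ ≠ zeroVec ∧ φ κ ∈ V₁ := by
    by_contra hno
    push Not at hno
    set ψ : (Fin 4 → Bool) → Finset (Fin (6 + 6) → Bool) := fun ε => V₁.image (bxor (φ ε)) with hψ
    have hdisj : ∀ ε ∈ (univ : Finset (Fin 4 → Bool)), ∀ ε' ∈ (univ : Finset (Fin 4 → Bool)), ε ≠ ε' → Disjoint (ψ ε) (ψ ε') := by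
      intro ε _ ε' _ hne
      rw [Finset.disjoint_left]
      intro y hy hy'
      obtain ⟨v, hv, rfl⟩ := mem_image.1 hy
      obtain ⟨v', hv', hvv⟩ := mem_image.1 hy'
      have e1 : bxor (φ ε) (φ ε') = bxor v v' := by
        funext j
        have hj := congrFun hvv j
        simp only [bxor] at hj ⊢
        revert hj
        cases φ ε j <;> cases φ ε' j <;> cases v j <;> cases v' j <;> decide
      have hκ : φ (bxor ε ε') ∈ V₁ := by rw [hφadd, e1]; exact h1add v hv v' hv'
      have hne' : bxor ε ε' ≠ zeroVec := by
        intro h0'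
        apply hne
        have := congrArg (bxor ε) h0'
        rw [bxor_bxor_cancel_left, bxor_zeroVec] at this
        exact this.symm
      exact hno (bxor ε ε') hne' hκ
    have hsubV : ∀ ε, ψ ε ⊆ V := by
      intro ε y hy
      obtain ⟨v, hv, rfl⟩ := mem_image.1 hy
      exact hadd _ (hφV ε) v (hsub hv)
    have hcardψ : ∀ ε, #(ψ ε) = 256 := fun ε => by
      simp only [ψ]; rw [card_image_of_injective _ (iw_bxor_injective _), h1card]
    have hU : #((univ : Finset (Fin 4 → Bool)).biUnion ψ) = 16 * 256 := by
      rw [card_biUnion hdisj]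
      simp only [hcardψ, sum_const, card_univ, Fintype.card_fun, Fintype.card_bool, Fintype.card_fin, smul_eq_mul]
      norm_num
    have hle : #((univ : Finset (Fin 4 → Bool)).biUnion ψ) ≤ #V :=
      card_le_card (biUnion_subset.2 fun ε _ => hsubV ε)
    rw [hU, hcardV] at hle
    norm_num at hle
  obtain ⟨κ, hκ0, hκV₁⟩ := hpig
  -- the section is invariant under `ε ↦ ε ⊕ κ`
  set S := univ.filter (fun ε : Fin 4 → Bool => (fun j => z j ^^ decide (Odd #(univ.filter fun i => ε i && a i j))) ∈ V₁.image (bxor c')) with hS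
  have hSmem : ∀ ε, ε ∈ S ↔ bxor w₀ (φ ε) ∈ V₁ := by
    intro ε; rw [hS, mem_filter, hpt ε, hmem ε]; simp
  have hinv : ∀ ε, ε ∈ S → bxor ε κ ∈ S := by
    intro ε h
    rw [hSmem] at h ⊢
    rw [hφadd, ← iw_bxor_assoc]
    exact h1add _ h _ hκV₁
  -- split `S` by a coordinate where `κ` is `true`
  have hi : ∃ i, κ i = true := by
    by_contra hno
    push Not at hno
    exact hκ0 (funext fun i => by simpa [zeroVec] using hno i)
  obtain ⟨i, hi⟩ := hi
  have hsplit := card_filter_add_card_filter_not (s := S) (fun ε : Fin 4 → Bool => ε i = true)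
  have hbij : #(S.filter fun ε : Fin 4 → Bool => ε i = true) = #(S.filter fun ε : Fin 4 → Bool => ¬ ε i = true) := by
    refine card_nbij' (fun ε => bxor ε κ) (fun ε => bxor ε κ) (fun ε hε => ?_) (fun ε hε => ?_)
      (fun ε _ => by show bxor (bxor ε κ) κ = ε; rw [iw_bxor_assoc, bxor_self, bxor_zeroVec])
      (fun ε _ => by show bxor (bxor ε κ) κ = ε; rw [iw_bxor_assoc, bxor_self, bxor_zeroVec])
    · rw [mem_coe, mem_filter] at hε ⊢
      refine ⟨hinv ε hε.1, ?_⟩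
      simp only [bxor, hε.2, hi]; decide
    · rw [mem_coe, mem_filter] at hε ⊢
      refine ⟨hinv ε hε.1, ?_⟩
      have h2 : ε i = false := by simpa using hε.2
      simp only [bxor, h2, hi]; decide
  rw [← hsplit, hbij]
  exact ⟨_, rfl⟩

end Summit.QuantumAdvantage.QuantumAdvantage.Theorems.CubicForrelation.NearExactIsExact

end
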